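import Literature.NumberTheory.Automorphic.StrongArtinGL2GlobalQuotientUnitProofs
import Literature.NumberTheory.GaloisRepresentations.FramedRepTwist
import HarnessLib

/-!
# Gelbart's Prop. 4.1: the Artin side of the global package from Artin's functional equation
(pure proofs; companion to `Automorphic/StrongArtinGL2GlobalQuotientUnitProofs`)

`frobSatake_of_global_functional_equations_of_norm_eq_one`
(`StrongArtinGL2GlobalQuotientUnitProofs`) proves Gelbart's Prop. 4.1 at a place `v` for an Artin
representation `ρ : Γ_F → GL₂(ℂ)` from a *global analytic package*: four functions (the completed,
twisted L-functions of `π`, `ρ` and of their contragredients) with functional equations and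
Euler-product agreements.  Here the `ρ`-half of the package is **instantiated from the tree's
Artin L-function**: if `ρ` and its contragredient `ρ^∨ = (ρᵀ)⁻¹` (`FramedRep.dual`) satisfy
Artin's functional equation in the tree's sense
(`GaloisRepresentations.ArtinRep.SatisfiesFunctionalEquation ρ ρ^∨`: meromorphic `Λ, Λ'`
continuing `Λ(s, ρ) = A(ρ)^{s/2} γ(ρ, s) L(s, ρ)` and `Λ(s, ρ^∨)` from `re s > 1`, with
`Λ(1 - s) = W Λ'(s)`, `|W| = 1` — the instance at `ρ` of the named fact
`artin_functional_equation`, Neukirch VII (12.6)), then Prop. 4.1 at `v` for `ρ` follows from the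
**automorphic half alone**, stated against the Artin L-functions of `ρ` and `ρ^∨`:
meromorphic `Λ_π, Λ_π'` with `Λ_π(s) = ε_π(s) Λ_π'(1 - s)` (`ε_π` continuous, nowhere zero),
entire reciprocal archimedean factors `Γ_π, Γ_π'` vanishing on finitely many horizontal lines, and
for `re s > c ≥ 1`
`Λ_π(s) ∏_{a ∈ α} (1 - a q^{-s}) Γ_π(s) = L(s, ρ) L_v(ρ, q^{-s})` and
`Λ_π'(s) ∏_{a ∈ α} (1 - a⁻¹ q^{-s}) Γ_π'(s) = L(s, ρ^∨) L_v(ρ^∨, q^{-s})`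
(i.e. the Euler factors of `L(s, ω ⊗ π)` and of `L(s, ρ) = L(s, ω ⊗ σ)`, `ρ = σ ⊗ ω`, agree at
every finite place other than `v`, those of `π` at `v` being the Satake factors of `α`); the
non-vanishing of `Λ_π'` somewhere is automatic from that of `L(s, ρ^∨)` on `re s > 1`.

* `ArtinRep.exists_gammaFactor_inv` — `1/γ(ρ, s)` is an entire function vanishing only on the
  real axis (a finite product of powers of `1/Γ_ℝ(s)`, `1/Γ_ℝ(s + 1)`; sharpens
  `ArtinRep.exists_differentiable_mul_gammaFactor_eq_one` by the location of the zeros,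
  Mathlib `Complex.Gammaℝ_eq_zero_iff`).
* `frobSatake_of_satisfiesFunctionalEquation` — the theorem just described
  (Jacquet–Langlands 1970, pp. 209–211, with `Λ_σ = Λ`, `Λ_σ' = Λ'`, `ε_σ = W`,
  `Γ_σ = A(ρ)^{-s/2} γ(ρ, s)⁻¹`, `Γ_σ' = A(ρ^∨)^{-s/2} γ(ρ^∨, s)⁻¹`).

What remains encoded as hypotheses (absent from the tree): the automorphic half — Jacquet–Langlands
Thm. 11.1, Cor. 11.2 for the cuspidal Borel–Jacquet datum `π` twisted by an idèle class character
`ω` unramified at `v` and highly ramified at the other exceptional places (Lemma 12.5) — and the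
twist `ρ = σ ⊗ ω` itself (`FramedRep.twist`).

No new definition and no named fact is introduced (D-0026).

## References

* H. Jacquet, R. P. Langlands, *Automorphic Forms on GL(2)*, LNM 114 (1970): proof of Thm. 12.2,
  pp. 209–211 (retypeset ed.). [JacquetLanglands1970]
* J. Neukirch, *Algebraic Number Theory* (1999), VII §12, (12.5)–(12.6). [NeukirchANT1999]
* S. Gelbart, *Three lectures on the modularity of `ρ̄_{E,3}` …* (1997): Prop. 4.1. [Gelbart1997]
-/

noncomputable section

open scoped MatrixGroups NumberField Polynomial
open NumberField IsDedekindDomain Field Polynomial Complex Filter Topology Set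
open Literature.NumberTheory.GaloisRepresentations (ArtinRep FramedArtinRep)
open Literature.NumberTheory.LFunctions

/-! ### `1/γ(ρ, s)` is entire with real zeros -/

namespace Literature.NumberTheory.GaloisRepresentations.ArtinRep

variable {K : Type*} [Field K] [NumberField K] {V : Type*} [AddCommGroup V] [Module ℂ V]
  [TopologicalSpace V]

/-- **`1/γ(ρ, s)` is entire and vanishes only on the real axis**: there is an entire `γinv` with
`γ(ρ, s) γinv(s) = 1` for `re s > 0` and `γinv(s) = 0 ⇒ im s = 0`, namely the finite product of
powers of `1/Γ_ℝ(s)` and `1/Γ_ℝ(s + 1)` inverting the factors of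
`γ(ρ, s) = ∏_{w real} Γ_ℝ(s)^{n⁺_w} Γ_ℝ(s+1)^{n⁻_w} ∏_{w complex} Γ_ℂ(s)^{dim V}`
(`Γ_ℂ(s) = Γ_ℝ(s) Γ_ℝ(s + 1)`); `1/Γ_ℝ` is entire with zeros at `0, -2, -4, …` (Mathlib
`Complex.differentiable_Gammaℝ_inv`, `Complex.Gammaℝ_eq_zero_iff`).  Sharpens
`exists_differentiable_mul_gammaFactor_eq_one`. Ref: Neukirch VII §12, (12.5). [folklore] -/
theorem exists_gammaFactor_inv (ρ : ArtinRep K V) :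
    ∃ γinv : ℂ → ℂ, Differentiable ℂ γinv ∧ (∀ s : ℂ, 0 < s.re → ρ.gammaFactor s * γinv s = 1) ∧
      ∀ s : ℂ, γinv s = 0 → s.im = 0 := by
  classical
  let ginv : InfinitePlace K → ℂ → ℂ := fun w s =>
    if hw : w.IsReal then
      (Gammaℝ s)⁻¹ ^ (ρ.signature (InfinitePlace.embedding_of_isReal hw)).1 *
        (Gammaℝ (s + 1))⁻¹ ^ (ρ.signature (InfinitePlace.embedding_of_isReal hw)).2
    else ((Gammaℝ s)⁻¹ * (Gammaℝ (s + 1))⁻¹) ^ Module.finrank ℂ V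
  have hinv1 : Differentiable ℂ fun s : ℂ => (Gammaℝ (s + 1))⁻¹ :=
    differentiable_Gammaℝ_inv.comp (differentiable_id.add_const 1)
  have hginv : ∀ w, Differentiable ℂ (ginv w) := by
    intro w
    by_cases hw : w.IsReal
    · simp only [ginv, hw, ↓reduceDIte]
      exact (differentiable_Gammaℝ_inv.pow _).mul (hinv1.pow _)
    · simp only [ginv, hw, ↓reduceDIte]
      exact (differentiable_Gammaℝ_inv.mul hinv1).pow _
  -- the zeros of the two building blocks are real
  have hG : ∀ {z : ℂ}, (Gammaℝ z)⁻¹ = 0 → z.im = 0 := fun {z} hz => by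
    obtain ⟨n, hn⟩ := Gammaℝ_eq_zero_iff.mp (inv_eq_zero.mp hz)
    rw [hn]
    simp
  have hG1 : ∀ {z : ℂ}, (Gammaℝ (z + 1))⁻¹ = 0 → z.im = 0 := fun {z} hz => by
    simpa using hG hz
  refine ⟨fun s => ∏ w : InfinitePlace K, ginv w s, ?_, fun s hs => ?_, fun s hs => ?_⟩
  · exact Differentiable.fun_finsetProd fun w _ => hginv w
  · have h0 : Gammaℝ s ≠ 0 := Gammaℝ_ne_zero_of_re_pos hs
    have h1 : Gammaℝ (s + 1) ≠ 0 := Gammaℝ_ne_zero_of_re_pos (by rw [add_re, one_re]; linarith)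
    unfold gammaFactor
    rw [← Finset.prod_mul_distrib]
    refine Finset.prod_eq_one fun w _ => ?_
    by_cases hw : w.IsReal
    · simp only [ginv, hw, ↓reduceDIte]
      rw [mul_mul_mul_comm, ← mul_pow, ← mul_pow, mul_inv_cancel₀ h0, mul_inv_cancel₀ h1,
        one_pow, one_pow, one_mul]
    · simp only [ginv, hw, ↓reduceDIte]
      rw [← mul_pow, ← Gammaℝ_mul_Gammaℝ_add_one, mul_mul_mul_comm, mul_inv_cancel₀ h0,
        mul_inv_cancel₀ h1, one_mul, one_pow]
  · obtain ⟨w, -, hw0⟩ := Finset.prod_eq_zero_iff.mp hs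
    by_cases hw : w.IsReal
    · simp only [ginv, hw, ↓reduceDIte] at hw0
      rcases mul_eq_zero.mp hw0 with h | h
      · exact hG (pow_eq_zero_iff'.mp h).1
      · exact hG1 (pow_eq_zero_iff'.mp h).1
    · simp only [ginv, hw, ↓reduceDIte] at hw0
      rcases mul_eq_zero.mp (pow_eq_zero_iff'.mp hw0).1 with h | h
      · exact hG h
      · exact hG1 h

end Literature.NumberTheory.GaloisRepresentations.ArtinRep

namespace Literature.NumberTheory.Automorphic

/-! ### Prop. 4.1 at `v` from Artin's functional equation and the automorphic half -/

section ArtinSide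

variable {F : Type*} [Field F] [NumberField F]

/-- **Gelbart's Prop. 4.1 at one place from Artin's functional equation and the automorphic half
of the global package** (Jacquet–Langlands 1970, proof of Thm. 12.2, pp. 209–211).  Let
`ρ : Γ_F → GL₂(ℂ)` be an Artin representation which, with its contragredient `ρ^∨`
(`FramedRep.dual ρ`), satisfies Artin's functional equation
(`ArtinRep.SatisfiesFunctionalEquation`; the named fact `artin_functional_equation` at `ρ`), `v` a
finite place, `q = N v`, and `α` a multiset of two non-zero complex numbers.  Suppose given
meromorphic `Λ_π, Λ_π'` on `ℂ` with `Λ_π(s) = ε_π(s) Λ_π'(1 - s)` for all `s` (`ε_π` continuous,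
nowhere zero), entire `Γ_π, Γ_π'` vanishing only on finitely many horizontal lines, `c ≥ 1`, such
that for `re s > c`
`Λ_π(s) ∏_{a ∈ α} (1 - a q^{-s}) Γ_π(s) = L(s, ρ) L_v(ρ, q^{-s})` and
`Λ_π'(s) ∏_{a ∈ α} (1 - a⁻¹ q^{-s}) Γ_π'(s) = L(s, ρ^∨) L_v(ρ^∨, q^{-s})`
(`L(s, ·) = artinLFunction`, `L_v(·, T) = ArtinRep.eulerFactorAt`).  Then `ρ` is unramified at
`v` with `charpoly ρ(Frob_v) = ∏_{a ∈ α} (X - a)` (that `Λ_π' ≢ 0` is now automatic: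
`L(s, ρ^∨) L_v(ρ^∨, q^{-s}) ≠ 0` for `re s > 1`, `artinLFunction_ne_zero_of_one_lt_re`,
`ArtinRep.eval_eulerFactorAt_ne_zero`).
Proof: `frobSatake_of_global_functional_equations_of_norm_eq_one` for `(ρ, ρ^∨)` with `Λ_σ = Λ`,
`Λ_σ' = Λ'`, `ε_σ = W`, `Γ_σ(s) = A(ρ)^{-s/2} γ(ρ, s)⁻¹`, `Γ_σ'(s) = A(ρ^∨)^{-s/2} γ(ρ^∨, s)⁻¹`
(`ArtinRep.exists_gammaFactor_inv`, `ArtinRep.artinConductorNorm_ne_zero'`): on `re s > 1`,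
`Λ(s) L_v(ρ, q^{-s}) Γ_σ(s) = L(s, ρ) L_v(ρ, q^{-s})`.
[cite: JacquetLanglands1970, proof of Thm. 12.2, pp. 209–211]
[cite: NeukirchANT1999, VII §12, Thm. (12.6)] -/
theorem frobSatake_of_satisfiesFunctionalEquation (ρ : FramedArtinRep F 2)
    (v : HeightOneSpectrum (𝓞 F)) {α : Multiset ℂ} (hcard : Multiset.card α = 2)
    (h0 : (0 : ℂ) ∉ α)
    (hFE : ρ.toArtinRep.SatisfiesFunctionalEquation
      (FramedArtinRep.toArtinRep (GaloisRepresentations.FramedRep.dual ρ)))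
    {Λπ Λπ' : ℂ → ℂ} (hΛπ : Meromorphic Λπ) (hΛπ' : Meromorphic Λπ')
    {Γπ Γπ' επ : ℂ → ℂ} (hΓπ : Differentiable ℂ Γπ) (hΓπ' : Differentiable ℂ Γπ')
    (hYπ : ∃ Y : Set ℝ, Y.Finite ∧ ∀ s, Γπ s = 0 → s.im ∈ Y)
    (hYπ' : ∃ Y : Set ℝ, Y.Finite ∧ ∀ s, Γπ' s = 0 → s.im ∈ Y)
    (hεπ : Continuous επ) (hεπ0 : ∀ s, επ s ≠ 0) {c : ℝ} (hc : 1 ≤ c)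
    (hEπ : ∀ s : ℂ, c < s.re →
      Λπ s * ((α.map fun a => eulerTerm v.residueCard a s).prod * Γπ s) =
        GaloisRepresentations.artinLFunction ρ.toArtinRep s *
          (ρ.toArtinRep.eulerFactorAt v).eval ((v.residueCard : ℂ) ^ (-s)))
    (hEπ' : ∀ s : ℂ, c < s.re →
      Λπ' s * ((α.map fun a => eulerTerm v.residueCard a⁻¹ s).prod * Γπ' s) =
        GaloisRepresentations.artinLFunction
            (FramedArtinRep.toArtinRep (GaloisRepresentations.FramedRep.dual ρ)) s *
          ((FramedArtinRep.toArtinRep (GaloisRepresentations.FramedRep.dual ρ)).eulerFactorAt v).eval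
            ((v.residueCard : ℂ) ^ (-s)))
    (hFπ : ∀ s, Λπ s = επ s * Λπ' (1 - s)) :
    ρ.IsUnramifiedAt v ∧ ρ.HasFrobCharpolyAt v (satakePolynomial α) := by
  set ρ' : FramedArtinRep F 2 := GaloisRepresentations.FramedRep.dual ρ with hρ'
  obtain ⟨Λ, Λ', hΛ, hΛ', hagree, W, hW1, hW⟩ := hFE
  -- the reciprocal completed factors of `ρ` and `ρ^∨`
  obtain ⟨γi, hγid, hγi, hγi0⟩ := ρ.toArtinRep.exists_gammaFactor_inv
  obtain ⟨γi', hγi'd, hγi', hγi'0⟩ := ρ'.toArtinRep.exists_gammaFactor_inv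
  have hA : (ρ.toArtinRep.artinConductorNorm : ℂ) ≠ 0 :=
    Nat.cast_ne_zero.2 ρ.toArtinRep.artinConductorNorm_ne_zero'
  have hA' : (ρ'.toArtinRep.artinConductorNorm : ℂ) ≠ 0 :=
    Nat.cast_ne_zero.2 ρ'.toArtinRep.artinConductorNorm_ne_zero'
  have hpowd : ∀ {A : ℂ}, A ≠ 0 → Differentiable ℂ fun s : ℂ => A ^ (-(s / 2)) := fun hA s =>
    DifferentiableAt.const_cpow ((differentiableAt_id.div_const 2).neg) (Or.inl hA)
  have hpow0 : ∀ {A : ℂ}, A ≠ 0 → ∀ s : ℂ, A ^ (-(s / 2)) ≠ 0 := fun hA s h =>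
    hA ((cpow_eq_zero_iff _ _).1 h).1
  have hpow1 : ∀ {A : ℂ}, A ≠ 0 → ∀ s : ℂ, A ^ (s / 2) * A ^ (-(s / 2)) = 1 := fun hA s => by
    rw [cpow_neg, mul_inv_cancel₀ fun h => hA ((cpow_eq_zero_iff _ _).1 h).1]
  -- the common exceptional set
  obtain ⟨P, hPc, hP, hPs, hPa⟩ := exists_isClosed_countable_analyticAt hΛπ hΛ hΛπ' hΛ'
  -- `Λ_π' ≢ 0` off `P`: `L(s, ρ^∨) L_v(ρ^∨, q^{-s}) ≠ 0` for `re s > 1`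
  have hNV' : ∃ s, s ∉ P ∧ Λπ' s ≠ 0 := by
    obtain ⟨s, hsc, hsP⟩ := (Set.Countable.dense_compl ℂ hP).inter_open_nonempty
      {s : ℂ | c < s.re} (isOpen_lt continuous_const Complex.continuous_re)
      ⟨((c + 1 : ℝ) : ℂ), by simp⟩
    have hsc : c < s.re := hsc
    have hne : Λπ' s * ((α.map fun a => eulerTerm v.residueCard a⁻¹ s).prod * Γπ' s) ≠ 0 := by
      rw [hEπ' s hsc]
      exact mul_ne_zero
        (GaloisRepresentations.artinLFunction_ne_zero_of_one_lt_re ρ'.toArtinRep (by linarith))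
        (ρ'.toArtinRep.eval_eulerFactorAt_ne_zero v (by linarith))
    exact ⟨s, hsP, left_ne_zero_of_mul hne⟩
  have hd : ∀ {f : ℂ → ℂ}, (∀ s, s ∉ P → AnalyticAt ℂ f s) → DifferentiableOn ℂ f Pᶜ :=
    fun h s hs => (h s hs).differentiableAt.differentiableWithinAt
  refine frobSatake_of_global_functional_equations_of_norm_eq_one ρ ρ' v hcard h0 hPc hP hPs
    (hd fun s hs => (hPa s hs).1) (hd fun s hs => (hPa s hs).2.1)
    (hd fun s hs => (hPa s hs).2.2.1) (hd fun s hs => (hPa s hs).2.2.2)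
    (Γσ := fun s => (ρ.toArtinRep.artinConductorNorm : ℂ) ^ (-(s / 2)) * γi s)
    (Γσ' := fun s => (ρ'.toArtinRep.artinConductorNorm : ℂ) ^ (-(s / 2)) * γi' s)
    (εσ := fun _ => W)
    hΓπ ((hpowd hA).mul hγid) hΓπ' ((hpowd hA').mul hγi'd) hεπ continuous_const hεπ0
    (fun _ => norm_ne_zero_iff.mp (by rw [hW1]; exact one_ne_zero)) hYπ
    ⟨{0}, Set.finite_singleton 0, fun s hs =>
      hγi0 s ((mul_eq_zero.mp hs).resolve_left (hpow0 hA s))⟩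
    hYπ'
    ⟨{0}, Set.finite_singleton 0, fun s hs =>
      hγi'0 s ((mul_eq_zero.mp hs).resolve_left (hpow0 hA' s))⟩
    (c := c) (fun s hs _ => ?_) (fun s hs _ => ?_) (fun s _ => hFπ s) (fun s _ => ?_) hNV'
  · -- `Λ(s) L_v(ρ, q^{-s}) Γ_σ(s) = L(s, ρ) L_v(ρ, q^{-s})` on `re s > 1`
    have hs1 : 1 < s.re := by linarith
    have hs0 : 0 < s.re := by linarith
    have key : (ρ.toArtinRep.artinConductorNorm : ℂ) ^ (s / 2) * ρ.toArtinRep.gammaFactor s *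
        ((ρ.toArtinRep.artinConductorNorm : ℂ) ^ (-(s / 2)) * γi s) = 1 := by
      calc (ρ.toArtinRep.artinConductorNorm : ℂ) ^ (s / 2) * ρ.toArtinRep.gammaFactor s *
            ((ρ.toArtinRep.artinConductorNorm : ℂ) ^ (-(s / 2)) * γi s)
          = ((ρ.toArtinRep.artinConductorNorm : ℂ) ^ (s / 2) *
              (ρ.toArtinRep.artinConductorNorm : ℂ) ^ (-(s / 2))) *
              (ρ.toArtinRep.gammaFactor s * γi s) := by ring
        _ = 1 := by rw [hpow1 hA s, hγi s hs0, one_mul]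
    rw [hEπ s hs, (hagree s hs1).1, GaloisRepresentations.completedArtinLFunction]
    linear_combination (-(GaloisRepresentations.artinLFunction ρ.toArtinRep s *
      (ρ.toArtinRep.eulerFactorAt v).eval ((v.residueCard : ℂ) ^ (-s)))) * key
  · -- the same for `ρ^∨`
    have hs1 : 1 < s.re := by linarith
    have hs0 : 0 < s.re := by linarith
    have key : (ρ'.toArtinRep.artinConductorNorm : ℂ) ^ (s / 2) * ρ'.toArtinRep.gammaFactor s *
        ((ρ'.toArtinRep.artinConductorNorm : ℂ) ^ (-(s / 2)) * γi' s) = 1 := by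
      calc (ρ'.toArtinRep.artinConductorNorm : ℂ) ^ (s / 2) * ρ'.toArtinRep.gammaFactor s *
            ((ρ'.toArtinRep.artinConductorNorm : ℂ) ^ (-(s / 2)) * γi' s)
          = ((ρ'.toArtinRep.artinConductorNorm : ℂ) ^ (s / 2) *
              (ρ'.toArtinRep.artinConductorNorm : ℂ) ^ (-(s / 2))) *
              (ρ'.toArtinRep.gammaFactor s * γi' s) := by ring
        _ = 1 := by rw [hpow1 hA' s, hγi' s hs0, one_mul]
    rw [hEπ' s hs, (hagree s hs1).2, GaloisRepresentations.completedArtinLFunction]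
    linear_combination (-(GaloisRepresentations.artinLFunction ρ'.toArtinRep s *
      (ρ'.toArtinRep.eulerFactorAt v).eval ((v.residueCard : ℂ) ^ (-s)))) * key
  · -- the functional equation `Λ(s) = W Λ'(1 - s)`
    have h := hW (1 - s)
    rwa [sub_sub_cancel] at h

/-! ### Twists trivial at `v`, and the named fact -/

omit [NumberField F] in
/-- **A twist by a character trivial on the decomposition data at `v` does not change the local
behaviour at `v`.**  If `χ : Γ_F → ℂˣ` is trivial on the inertia groups `I_𝔓` and on the
arithmetic Frobenius elements at every `𝔓 ∣ v`, then `σ ⊗ χ` unramified at `v` with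
`charpoly (σ ⊗ χ)(Frob_v) = P` implies the same for `σ`: `(σ ⊗ χ)(g) = σ(g)` for all these `g`
(`FramedRep.twist_apply_of_eq_one`).  This is the situation of Jacquet–Langlands 1970, p. 210,
where the idèle class character `ω` is chosen with `ω_v = 1` (Lemma 12.5). [folklore] -/
theorem isUnramifiedAt_and_hasFrobCharpolyAt_of_twist (σ : FramedArtinRep F 2)
    (χ : absoluteGaloisGroup F →ₜ* ℂˣ) (v : HeightOneSpectrum (𝓞 F)) (P : ℂ[X])
    (hχI : ∀ 𝔓 ∈ v.primesAbove, ∀ g ∈ 𝔓.inertia (absoluteGaloisGroup F), χ g = 1)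
    (hχF : ∀ 𝔓 ∈ v.primesAbove, ∀ g : absoluteGaloisGroup F, IsArithFrobAt (𝓞 F) g 𝔓 → χ g = 1)
    (h : GaloisRepresentations.FramedGaloisRep.IsUnramifiedAt v
        (GaloisRepresentations.FramedRep.twist σ χ) ∧
      GaloisRepresentations.FramedGaloisRep.HasFrobCharpolyAt v P
        (GaloisRepresentations.FramedRep.twist σ χ)) :
    σ.IsUnramifiedAt v ∧ σ.HasFrobCharpolyAt v P := by
  refine ⟨fun 𝔓 h𝔓 g hg => ?_, fun 𝔓 h𝔓 g hg => ?_⟩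
  · rw [← GaloisRepresentations.FramedRep.twist_apply_of_eq_one σ χ (hχI 𝔓 h𝔓 g hg)]
    exact h.1 𝔓 h𝔓 g hg
  · have h2 := h.2 𝔓 h𝔓 g hg
    unfold GaloisRepresentations.FramedRep.charpoly at h2 ⊢
    rwa [GaloisRepresentations.FramedRep.twist_apply_of_eq_one σ χ (hχF 𝔓 h𝔓 g hg)] at h2

section NamedFact

open scoped Classical

/-- **Gelbart's Prop. 4.1 from Artin's functional equation and the automorphic half.**  The named
fact `frobSatakeCompatibleAt_of_isPiOfArtinRep` follows from (FE) Artin's functional equation for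
framed Artin representations of every number field (the named fact `artin_functional_equation`,
threaded as the hypothesis `hAFE`) and the statement — displayed inline as `H`; it is what
Jacquet–Langlands 1970, Thm. 11.1, Cor. 11.2 and Lemma 12.5 provide — that whenever the cuspidal
`π = π(σ)` has Satake parameter `α` at `v`, there is a continuous character `χ : Γ_F → ℂˣ` trivial
on the inertia groups and the Frobenius elements above `v` (the Galois avatar of an idèle class
character `ω` with `ω_v = 1`) together with the automorphic half of the global package relative to
`ρ = σ ⊗ χ`: meromorphic `Λ_π, Λ_π'` (`L(s, ω ⊗ π)`, `L(s, ω⁻¹ ⊗ π̃)` completed), a functional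
equation `Λ_π(s) = ε_π(s) Λ_π'(1 - s)`, entire reciprocal archimedean factors with zeros on finitely
many horizontal lines, and the Euler-factor agreements
`Λ_π(s) ∏_{a ∈ α}(1 - a q^{-s}) Γ_π(s) = L(s, ρ) L_v(ρ, q^{-s})`,
`Λ_π'(s) ∏_{a ∈ α}(1 - a⁻¹ q^{-s}) Γ_π'(s) = L(s, ρ^∨) L_v(ρ^∨, q^{-s})` on `re s > c ≥ 1`
(all local factors of `ω ⊗ π` and `ω ⊗ σ` away from `v` agree: at the unramified places because
`π = π(σ)`, at the other exceptional places because `ω` is so ramified there that both are `1`).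
[cite: JacquetLanglands1970, proof of Thm. 12.2, pp. 209–211] [cite: Gelbart1997, Prop. 4.1] -/
theorem frobSatakeCompatibleAt_of_isPiOfArtinRep_of_artinFE
    (hAFE : ∀ (F : Type) [Field F] [NumberField F], artin_functional_equation (K := F))
    (H : ∀ {F : Type} [Field F] [NumberField F] (hcpt : isCompact_glFiniteIntegralLevel 2 F)
      (σ : FramedArtinRep F 2) (π : CuspidalAutomorphicRepData 2 F hcpt),
      IsPiOfArtinRep σ π.1 → ∀ (v : HeightOneSpectrum (𝓞 F)) (α : Multiset ℂ),
        π.1.HasSatakeParamAt v α →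
        ∃ (χ : absoluteGaloisGroup F →ₜ* ℂˣ) (Λπ Λπ' Γπ Γπ' επ : ℂ → ℂ) (c : ℝ),
          (∀ 𝔓 ∈ v.primesAbove, ∀ g ∈ 𝔓.inertia (absoluteGaloisGroup F), χ g = 1) ∧
          (∀ 𝔓 ∈ v.primesAbove, ∀ g : absoluteGaloisGroup F,
            IsArithFrobAt (𝓞 F) g 𝔓 → χ g = 1) ∧
          Meromorphic Λπ ∧ Meromorphic Λπ' ∧ Differentiable ℂ Γπ ∧ Differentiable ℂ Γπ' ∧
          (∃ Y : Set ℝ, Y.Finite ∧ ∀ s, Γπ s = 0 → s.im ∈ Y) ∧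
          (∃ Y : Set ℝ, Y.Finite ∧ ∀ s, Γπ' s = 0 → s.im ∈ Y) ∧
          Continuous επ ∧ (∀ s, επ s ≠ 0) ∧ 1 ≤ c ∧
          (∀ s : ℂ, c < s.re →
            Λπ s * ((α.map fun a => eulerTerm v.residueCard a s).prod * Γπ s) =
              GaloisRepresentations.artinLFunction
                  (FramedArtinRep.toArtinRep (GaloisRepresentations.FramedRep.twist σ χ)) s *
                ((FramedArtinRep.toArtinRep
                  (GaloisRepresentations.FramedRep.twist σ χ)).eulerFactorAt v).eval
                  ((v.residueCard : ℂ) ^ (-s))) ∧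
          (∀ s : ℂ, c < s.re →
            Λπ' s * ((α.map fun a => eulerTerm v.residueCard a⁻¹ s).prod * Γπ' s) =
              GaloisRepresentations.artinLFunction
                  (FramedArtinRep.toArtinRep (GaloisRepresentations.FramedRep.dual
                    (GaloisRepresentations.FramedRep.twist σ χ))) s *
                ((FramedArtinRep.toArtinRep (GaloisRepresentations.FramedRep.dual
                  (GaloisRepresentations.FramedRep.twist σ χ))).eulerFactorAt v).eval
                  ((v.residueCard : ℂ) ^ (-s))) ∧
          (∀ s, Λπ s = επ s * Λπ' (1 - s))) :
    frobSatakeCompatibleAt_of_isPiOfArtinRep := by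
  intro F _ _ hcpt σ π hπ v α hα
  obtain ⟨χ, Λπ, Λπ', Γπ, Γπ', επ, c, hχI, hχF, hΛπ, hΛπ', hΓπ, hΓπ', hYπ, hYπ', hεπ, hεπ0, hc,
    hEπ, hEπ', hFπ⟩ := H hcpt σ π hπ v α hα
  have h0 : (0 : ℂ) ∉ α := fun h => hasSatakeParamAt_ne_zero_holds hα 0 h rfl
  exact isUnramifiedAt_and_hasFrobCharpolyAt_of_twist σ χ v _ hχI hχF
    (frobSatake_of_satisfiesFunctionalEquation (GaloisRepresentations.FramedRep.twist σ χ) v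
      hα.card_eq h0 (hAFE F _) hΛπ hΛπ' hΓπ hΓπ' hYπ hYπ' hεπ hεπ0 hc hEπ hEπ' hFπ)

end NamedFact

end ArtinSide

end Literature.NumberTheory.Automorphic
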